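import Literature.AlgebraicGeometry.Motives.HodgeLieWeightOneGradingTwoCommutant
import HarnessLib

/-!
# Weight-one Hodge structures with `dim 𝔤⁺ = dim 𝔤⁰ = 2` and `𝔷 = 0`, V: descent to `ℚ` — `dim End_Hdg(V) =
# k₁² + k₂²`, the centre of `End_Hdg(V)` is two-dimensional, and it is a REAL QUADRATIC FIELD unless `𝔥` has a
# proper ideal

Family `hodge`, layer `Literature/AlgebraicGeometry/Motives`; THEOREMS ONLY (no definition, no named fact; D-0026).
Eighth abstract file of the lane MT-RANK-SEVEN-SIMPLE of the cell `pub-hodgecm2` (COR-CM), seat `b27` gen 40; sequel of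
`Motives/HodgeLieWeightOneGradingTwoCommutant` (`End_Hdg(V) ⊗ ℂ` has dimension `k₁² + k₂²` and centre `ℂπ₁ ⊕ ℂπ₂`
for the two complementary real idempotents `πᵢ`).  Setting as there, plus `dim_ℚ Lie Hg(H) = 6`.  Write
`Z = End_Hdg(V) ∩ Z(End_Hdg(V))` for the centre of the algebra of Hodge endomorphisms (a `ℚ`-subspace of `End_ℚ V`).

* **`center_structure_of_finrank_gradingPlus_eq_two`** — (1) `dim_ℚ End_Hdg(V) = k₁² + k₂²`, `kᵢ ≥ 1`,
  `2(k₁ + k₂) = dim_ℚ V` (`finrank_span_baseChange_image`); (2) **`dim_ℚ Z = 2`**: every `z ∈ Z` has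
  `z_ℂ = c₁π₁ + c₂π₂` central in `End_Hdg ⊗ ℂ` with `c₁, c₂` REAL (`z_ℂ` and the `πᵢ` commute with `conj`), and
  conversely `πᵢ ∈ Z ⊗ ℂ` by commutant descent (`mem_span_baseChange_of_forall_commute` for the set
  `End_Hdg ∪ Lie Hg`: `πᵢ` commutes with both); (3) THE DICHOTOMY: EITHER `Lie Hg(H)` has a non-zero proper ideal —
  namely `{X ∈ 𝔥 : Xz = 0}` for a zero-divisor `z ∈ Z` (`z_ℂ = cπ₁`, so `𝔥z ⊗ ℂ ⊆ 𝔤π₁ ⊆ ℂE₁ + ℂF₁ + ℂ[E₁,F₁]` has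
  dimension `≤ 3 < 6`, while `E₁z_ℂ = cE₁ ≠ 0`) — OR **`Z` is a real quadratic field**: no zero-divisors,
  `Z = ℚ·1 ⊕ ℚ·φ` with `φ² = q·1`, `q ∈ ℚ_{>0}` not a square (`q = (2c₁ − a)²` with `c₁` real).

For a `ℚ`-SIMPLE `Lie Hg` (the situation of `CorCM/MumfordTateRankSevenSemisimple`) the first alternative is excluded:
the centre of `End⁰(X) ≅ End_Hdg(H¹X)` is a real quadratic field `K`, the abelian variety is isotypic, and the
arithmetic `dim End⁰ = k₁² + k₂²`, `dim X = k₁ + k₂` pins the simple factor down to an abelian surface with real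
multiplication by `K` or a fourfold with quaternion multiplication over `K` (`CorCM/MumfordTateRankSevenSimple*`).

## References

* [MoonenZarhin1999LowDim] B. Moonen, Yu. Zarhin, *Hodge classes on abelian varieties of low dimension*, Math. Ann. 315
  (1999), §2 («`End⁰(X) = End_{Hg} H¹`», reductivity) and (2.3) (types I(2), II(2)).
* [Zarhin1983HodgeGroupsK3] Yu. Zarhin, *Hodge groups of K3 surfaces*, J. reine angew. Math. 341 (1983), §2.
* [Deligne1982HodgeCycles] P. Deligne, *Hodge cycles on abelian varieties*, LNM 900 (1982), I §3 (proof of Prop. 3.4).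
-/

noncomputable section

open scoped TensorProduct

namespace Literature.AlgebraicGeometry.Motives

universe u

namespace HodgeStructure

open ProjectorBlocks Literature.RepresentationTheory.GeneralLinear

variable {V : Type u} [AddCommGroup V] [Module ℚ V] [Module.Finite ℚ V] [HodgeTensorFacts.{u, u}] {n : ℤ}
  {S : Type u} [Fintype S] [DecidableEq S] {deg : S → ℤ}

/-- **The centre of `End_Hdg(V)` when `dim 𝔤⁺ = dim 𝔤⁰ = 2`, `𝔷 = 0`, `dim 𝔥 = 6`.**  With
`Z = End_Hdg(V) ⊓ centralizer(End_Hdg(V))`: `dim_ℚ End_Hdg(V) = k₁² + k₂²` (`kᵢ ≥ 1`, `2(k₁+k₂) = dim_ℚ V`),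
**`dim_ℚ Z = 2`**, and EITHER `Lie Hg(H)` has a non-zero proper ideal (`{X ∈ 𝔥 : Xz = 0}` for a zero-divisor `z` of
`Z`) OR `Z` is a REAL QUADRATIC FIELD: no zero-divisors, `Z = ℚ·1 ⊕ ℚ·φ`, `φ² = q·1`, `0 < q ∈ ℚ` not a square.
[cite: MoonenZarhin1999LowDim, §2 and (2.3)] [cite: Zarhin1983HodgeGroupsK3, §2]
[cite: Deligne1982HodgeCycles, I §3 (proof of Prop. 3.4)] -/
theorem center_structure_of_finrank_gradingPlus_eq_two (H : HodgeStructure V n) (ψ : H.Polarization) (hn : n = 1)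
    (e : Module.Basis S ℂ (ℂ ⊗[ℚ] V)) (hF : ∀ a, H.F a = Submodule.span ℂ (e '' {σ | a ≤ deg σ}))
    (hFc : ∀ a, complexConj (H.F a) = Submodule.span ℂ (e '' {σ | deg σ ≤ n - a}))
    (hdeg : ∀ σ, deg σ = 0 ∨ deg σ = 1) (hcenter : H.hodgeLie ⊓ Subalgebra.toSubmodule H.endAlg = ⊥)
    (h6 : Module.finrank ℚ H.hodgeLie = 6)
    (hp2 : Module.finrank ℂ (H.hodgeLieC ⊓ Module.End.eigenspace
        (LinearMap.mulLeft ℂ (gradingEnd e deg) - LinearMap.mulRight ℂ (gradingEnd e deg)) 1 : Submodule ℂ _) = 2)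
    (h02 : Module.finrank ℂ (H.hodgeLieC ⊓ Module.End.eigenspace
        (LinearMap.mulLeft ℂ (gradingEnd e deg) - LinearMap.mulRight ℂ (gradingEnd e deg)) 0 : Submodule ℂ _) = 2) :
    ∃ k₁ k₂ : ℕ, 0 < k₁ ∧ 0 < k₂ ∧ 2 * (k₁ + k₂) = Module.finrank ℚ V ∧
      Module.finrank ℚ H.endAlg = k₁ ^ 2 + k₂ ^ 2 ∧
      Module.finrank ℚ (Subalgebra.toSubmodule
        (H.endAlg ⊓ Subalgebra.centralizer ℚ (H.endAlg : Set (Module.End ℚ V)))) = 2 ∧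
      ((∃ K : Submodule ℚ (Module.End ℚ V), K ≤ H.hodgeLie ∧ K ≠ ⊥ ∧ K ≠ H.hodgeLie ∧
          ∀ X ∈ K, ∀ Y ∈ H.hodgeLie, X * Y - Y * X ∈ K) ∨
        (∃ (φ : Module.End ℚ V) (q : ℚ),
          φ ∈ Subalgebra.toSubmodule (H.endAlg ⊓ Subalgebra.centralizer ℚ (H.endAlg : Set (Module.End ℚ V))) ∧
          0 < q ∧ ¬ IsSquare q ∧ φ * φ = q • (1 : Module.End ℚ V) ∧
          (∀ z ∈ Subalgebra.toSubmodule (H.endAlg ⊓ Subalgebra.centralizer ℚ (H.endAlg : Set (Module.End ℚ V))),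
            ∃ a b : ℚ, z = a • (1 : Module.End ℚ V) + b • φ) ∧
          (∀ z ∈ Subalgebra.toSubmodule (H.endAlg ⊓ Subalgebra.centralizer ℚ (H.endAlg : Set (Module.End ℚ V))),
            ∀ w ∈ Subalgebra.toSubmodule (H.endAlg ⊓ Subalgebra.centralizer ℚ (H.endAlg : Set (Module.End ℚ V))),
            z * w = 0 → z = 0 ∨ w = 0))) := by
  classical
  obtain ⟨E₁, F₁, E₂, F₂, π₁, π₂, k₁, k₂, ⟨hE₁g, -, hE₂g, -⟩, ⟨hππ₁, hππ₂, hπ₁π₂, hπ₂π₁, hsum1⟩, ⟨hre₁, hre₂⟩,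
    ⟨hπ₁A, hπ₂A⟩, hcrit, hπcomm, hcentre, hπind, ⟨hdimA, hk₁, hk₂, hdimV⟩, ⟨hgπ₁, hgπ₂⟩, ⟨hEπ₁, hE₁0, hEπ₂, hE₂0⟩,
    ⟨hπ₁g, hπ₂g⟩⟩ := exists_projectorPair_commutant H ψ hn e hF hFc hdeg hcenter hp2 h02
  set A : Submodule ℂ (Module.End ℂ (ℂ ⊗[ℚ] V)) :=
    Submodule.span ℂ ((fun a : Module.End ℚ V => a.baseChange ℂ) '' (H.endAlg : Set (Module.End ℚ V))) with hA
  set Zc : Submodule ℚ (Module.End ℚ V) := Subalgebra.toSubmodule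
    (H.endAlg ⊓ Subalgebra.centralizer ℚ (H.endAlg : Set (Module.End ℚ V))) with hZc
  have memZc : ∀ {z : Module.End ℚ V}, z ∈ Zc ↔ z ∈ H.endAlg ∧ ∀ a ∈ H.endAlg, a * z = z * a := fun {z} => by
    rw [hZc, Subalgebra.mem_toSubmodule, Algebra.mem_inf, Subalgebra.mem_centralizer_iff]
    rfl
  -- `Zc` is a subalgebra containing `1`
  have hZc1 : (1 : Module.End ℚ V) ∈ Zc := memZc.2 ⟨Subalgebra.one_mem _, fun a _ => by rw [mul_one, one_mul]⟩
  have hZcmul : ∀ z ∈ Zc, ∀ w ∈ Zc, z * w ∈ Zc := by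
    intro z hz w hw
    obtain ⟨hz1, hz2⟩ := memZc.1 hz
    obtain ⟨hw1, hw2⟩ := memZc.1 hw
    exact memZc.2 ⟨Subalgebra.mul_mem _ hz1 hw1, fun a ha => by rw [← mul_assoc, hz2 a ha, mul_assoc, hw2 a ha, mul_assoc]⟩
  -- injectivity of base change
  have bc_inj : ∀ {z : Module.End ℚ V}, z.baseChange ℂ = 0 → z = 0 := fun {z} h =>
    (Submodule.mem_bot ℚ).1 (mem_of_baseChange_mem_spanC ⊥ (by rw [h]; exact Submodule.zero_mem _))
  -- (2a) every `z ∈ Zc` has `z_ℂ = c₁π₁ + c₂π₂` with real `cᵢ`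
  have hdec : ∀ z ∈ Zc, ∃ c₁ c₂ : ℂ, z.baseChange ℂ = c₁ • π₁ + c₂ • π₂ ∧ starRingEnd ℂ c₁ = c₁ ∧
      starRingEnd ℂ c₂ = c₂ := by
    intro z hz
    obtain ⟨hzE, hzc⟩ := memZc.1 hz
    have hzA : z.baseChange ℂ ∈ A := Submodule.subset_span ⟨z, hzE, rfl⟩
    have hzcen : ∀ T ∈ A, z.baseChange ℂ * T = T * z.baseChange ℂ := by
      intro T hT
      induction hT using Submodule.span_induction with
      | mem T' hT' =>
        obtain ⟨a, ha, rfl⟩ := hT'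
        rw [← LinearMap.baseChange_mul, ← LinearMap.baseChange_mul, ← (hzc a ha)]
      | zero => rw [mul_zero, zero_mul]
      | add T₁ T₂ _ _ h₁ h₂ => rw [mul_add, add_mul, h₁, h₂]
      | smul c T₁ _ h₁ => rw [mul_smul_comm, smul_mul_assoc, h₁]
    obtain ⟨c₁, c₂, hzπ⟩ := hcentre _ hzA hzcen
    -- reality
    have hreal : (c₁ - starRingEnd ℂ c₁) • π₁ + (c₂ - starRingEnd ℂ c₂) • π₂ = 0 := by
      refine LinearMap.ext fun v => ?_
      have h1 : z.baseChange ℂ v = conj (z.baseChange ℂ (conj v)) := by rw [conj_baseChange, conj_conj]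
      rw [hzπ, LinearMap.add_apply, LinearMap.smul_apply, LinearMap.smul_apply, LinearMap.add_apply, LinearMap.smul_apply,
        LinearMap.smul_apply, map_add, conj_smul, conj_smul, ← hre₁, ← hre₂] at h1
      rw [LinearMap.add_apply, LinearMap.smul_apply, LinearMap.smul_apply, sub_smul, sub_smul, LinearMap.zero_apply]
      calc c₁ • π₁ v - (starRingEnd ℂ) c₁ • π₁ v + (c₂ • π₂ v - (starRingEnd ℂ) c₂ • π₂ v)
          = (c₁ • π₁ v + c₂ • π₂ v) - ((starRingEnd ℂ) c₁ • π₁ v + (starRingEnd ℂ) c₂ • π₂ v) := by abel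
        _ = 0 := by rw [h1, sub_self]
    obtain ⟨h1, h2⟩ := hπind _ _ hreal
    exact ⟨c₁, c₂, hzπ, (sub_eq_zero.1 h1).symm, (sub_eq_zero.1 h2).symm⟩
  -- (2b) `πᵢ ∈ Zc ⊗ ℂ` by commutant descent
  have hπZ : ∀ {π : Module.End ℂ (ℂ ⊗[ℚ] V)}, (∀ T ∈ A, T * π = π * T) → (∀ Y ∈ H.hodgeLieC, π * Y = Y * π) →
      π ∈ spanC Zc := by
    intro π hπA hπg
    have h := mem_span_baseChange_of_forall_commute ((H.endAlg : Set (Module.End ℚ V)) ∪ (H.hodgeLie : Set _))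
      (Y := π) fun X hX => by
        rcases hX with hX | hX
        · exact (hπA _ (Submodule.subset_span ⟨X, hX, rfl⟩)).symm
        · exact hπg _ (H.baseChange_mem_hodgeLieC hX)
    refine Submodule.span_mono ?_ h
    rintro _ ⟨b, hb, rfl⟩
    have hbE : b ∈ H.endAlg := H.mem_endAlg_of_forall_commute fun X hX => hb X (Or.inr hX)
    exact ⟨b, memZc.2 ⟨hbE, fun a ha => (hb a (Or.inl ha)).symm⟩, rfl⟩
  have hπ₁Z : π₁ ∈ spanC Zc := hπZ (fun T hT => (hπcomm T hT).1) hπ₁g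
  have hπ₂Z : π₂ ∈ spanC Zc := hπZ (fun T hT => (hπcomm T hT).2) hπ₂g
  -- (2c) `Zc ⊗ ℂ = ℂπ₁ ⊕ ℂπ₂`, so `dim_ℚ Zc = 2`
  have hindπ : LinearIndependent ℂ ![π₁, π₂] :=
    LinearIndependent.pair_iff.2 fun s t hst => hπind s t hst
  have hspanZ : spanC Zc = Submodule.span ℂ (Set.range ![π₁, π₂]) := by
    apply le_antisymm
    · refine Submodule.span_le.2 ?_
      rintro _ ⟨z, hz, rfl⟩
      obtain ⟨c₁, c₂, hzπ, -, -⟩ := hdec z hz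
      show z.baseChange ℂ ∈ Submodule.span ℂ (Set.range ![π₁, π₂])
      rw [hzπ]
      exact Submodule.add_mem _ (Submodule.smul_mem _ _ (Submodule.subset_span ⟨0, rfl⟩))
        (Submodule.smul_mem _ _ (Submodule.subset_span ⟨1, rfl⟩))
    · rw [Submodule.span_le, Set.range_subset_iff]
      intro i; fin_cases i
      · exact hπ₁Z
      · exact hπ₂Z
  have hZ2 : Module.finrank ℚ Zc = 2 := by
    rw [← finrank_span_baseChange_image Zc]
    change Module.finrank ℂ (spanC Zc) = 2
    rw [hspanZ, finrank_span_eq_card hindπ, Fintype.card_fin]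
  -- (1) `dim_ℚ End_Hdg = k₁² + k₂²`
  have hdimE : Module.finrank ℚ H.endAlg = k₁ ^ 2 + k₂ ^ 2 := by
    have h := finrank_span_baseChange_image (Subalgebra.toSubmodule H.endAlg)
    rw [Subalgebra.coe_toSubmodule, Subalgebra.finrank_toSubmodule] at h
    rw [← h]
    exact hdimA
  refine ⟨k₁, k₂, hk₁, hk₂, hdimV, hdimE, hZ2, ?_⟩
  -- products in `Zc` through the decomposition
  have hmuldec : ∀ {z w : Module.End ℚ V} {c₁ c₂ d₁ d₂ : ℂ}, z.baseChange ℂ = c₁ • π₁ + c₂ • π₂ →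
      w.baseChange ℂ = d₁ • π₁ + d₂ • π₂ → (z * w).baseChange ℂ = (c₁ * d₁) • π₁ + (c₂ * d₂) • π₂ := by
    intro z w c₁ c₂ d₁ d₂ hz hw
    rw [LinearMap.baseChange_mul, hz, hw]
    simp only [mul_add, add_mul, smul_mul_assoc, mul_smul_comm, hππ₁, hππ₂, hπ₁π₂, hπ₂π₁, smul_zero, add_zero,
      zero_add, smul_smul]
    rw [mul_comm d₁ c₁, mul_comm d₂ c₂]
  -- an ideal of `𝔥` from a `z ∈ End_Hdg` with `z_ℂ = c • π`
  have mkIdeal : ∀ {z : Module.End ℚ V} {c : ℂ} {π Eπ : Module.End ℂ (ℂ ⊗[ℚ] V)} (v3 : Fin 3 → Module.End ℂ (ℂ ⊗[ℚ] V)),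
      z ∈ H.endAlg → z ≠ 0 → z.baseChange ℂ = c • π → Eπ ∈ H.hodgeLieC → Eπ * π = Eπ → Eπ ≠ 0 →
      (∀ Y ∈ H.hodgeLieC, Y * π ∈ Submodule.span ℂ (Set.range v3)) →
      ∃ K : Submodule ℚ (Module.End ℚ V), K ≤ H.hodgeLie ∧ K ≠ ⊥ ∧ K ≠ H.hodgeLie ∧
        ∀ X ∈ K, ∀ Y ∈ H.hodgeLie, X * Y - Y * X ∈ K := by
    intro z c π Eπ v3 hzE hz0 hzc hEπg hEππ hEπ0 hv3
    refine ⟨H.hodgeLie ⊓ LinearMap.ker (LinearMap.mulRight ℚ z), inf_le_left, ?_, ?_, ?_⟩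
    · -- `K ≠ ⊥`: `dim (𝔥 z) ≤ 3 < 6 = dim 𝔥`
      intro hbot
      set f : H.hodgeLie →ₗ[ℚ] Module.End ℚ V := (LinearMap.mulRight ℚ z).domRestrict H.hodgeLie with hf
      have hker : LinearMap.ker f = ⊥ := by
        rw [eq_bot_iff]
        intro x hx
        have hx' : (x : Module.End ℚ V) ∈ H.hodgeLie ⊓ LinearMap.ker (LinearMap.mulRight ℚ z) := by
          refine ⟨x.2, ?_⟩
          rw [hf, LinearMap.mem_ker, LinearMap.domRestrict_apply] at hx
          exact hx
        rw [hbot, Submodule.mem_bot] at hx'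
        rw [Submodule.mem_bot]
        exact Subtype.ext hx'
      have hrank := LinearMap.finrank_range_add_finrank_ker f
      rw [hker, finrank_bot, add_zero, h6] at hrank
      -- `range f ⊗ ℂ ⊆ span v3`
      have hle : Submodule.span ℂ ((fun a : Module.End ℚ V => a.baseChange ℂ) '' (LinearMap.range f : Set _)) ≤
          Submodule.span ℂ (Set.range v3) := by
        refine Submodule.span_le.2 ?_
        rintro _ ⟨Y, ⟨x, rfl⟩, rfl⟩
        show (f x).baseChange ℂ ∈ Submodule.span ℂ (Set.range v3)
        rw [hf, LinearMap.domRestrict_apply, LinearMap.mulRight_apply, LinearMap.baseChange_mul, hzc, mul_smul_comm]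
        exact Submodule.smul_mem _ _ (hv3 _ (H.baseChange_mem_hodgeLieC x.2))
      have h3 : Module.finrank ℚ (LinearMap.range f) ≤ 3 := by
        rw [← finrank_span_baseChange_image (LinearMap.range f)]
        exact (Submodule.finrank_mono hle).trans ((finrank_range_le_card v3).trans (by simp))
      omega
    · -- `K ≠ 𝔥`: else `E_π z_ℂ = c E_π = 0`
      intro htop
      have hall : ∀ Y ∈ H.hodgeLieC, Y * z.baseChange ℂ = 0 := by
        intro Y hY
        induction hY using Submodule.span_induction with
        | mem Y' hY' =>
          obtain ⟨X, hX, rfl⟩ := hY'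
          have hXK : X ∈ H.hodgeLie ⊓ LinearMap.ker (LinearMap.mulRight ℚ z) := by rw [htop]; exact hX
          obtain ⟨-, hXz⟩ := Submodule.mem_inf.1 hXK
          rw [LinearMap.mem_ker, LinearMap.mulRight_apply] at hXz
          rw [← LinearMap.baseChange_mul, hXz, LinearMap.baseChange_zero]
        | zero => rw [zero_mul]
        | add Y₁ Y₂ _ _ h₁ h₂ => rw [add_mul, h₁, h₂, add_zero]
        | smul a Y₁ _ h₁ => rw [smul_mul_assoc, h₁, smul_zero]
      have h := hall _ hEπg
      rw [hzc, mul_smul_comm, hEππ] at h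
      rcases smul_eq_zero.1 h with hc | hE
      · apply hz0; apply bc_inj; rw [hzc, hc, zero_smul]
      · exact hEπ0 hE
    · -- ideal
      intro X hXK Y hY
      obtain ⟨hX, hXz⟩ := Submodule.mem_inf.1 hXK
      rw [LinearMap.mem_ker, LinearMap.mulRight_apply] at hXz
      refine Submodule.mem_inf.2 ⟨H.commutator_mem_hodgeLie hX hY, ?_⟩
      rw [LinearMap.mem_ker, LinearMap.mulRight_apply, sub_mul, mul_assoc X Y z, commute_of_mem_hodgeLie H hY ⟨z, hzE⟩,
        ← mul_assoc X z Y, hXz, zero_mul, mul_assoc Y X z, hXz, mul_zero, sub_zero]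
  by_cases hzd : ∃ z ∈ Zc, ∃ w ∈ Zc, z ≠ 0 ∧ w ≠ 0 ∧ z * w = 0
  · -- zero-divisors: an ideal of `𝔥`
    left
    obtain ⟨z, hz, w, hw, hz0, hw0, hzw⟩ := hzd
    obtain ⟨c₁, c₂, hzπ, -, -⟩ := hdec z hz
    obtain ⟨d₁, d₂, hwπ, -, -⟩ := hdec w hw
    have hprod := hmuldec hzπ hwπ
    rw [hzw, LinearMap.baseChange_zero] at hprod
    obtain ⟨h1, h2⟩ := hπind _ _ hprod.symm
    obtain ⟨hzE, -⟩ := memZc.1 hz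
    by_cases hc₁ : c₁ = 0
    · -- then `c₂ ≠ 0` and `z_ℂ = c₂ π₂`
      rw [hc₁, zero_smul, zero_add] at hzπ
      exact mkIdeal ![E₂, F₂, E₂ * F₂ - F₂ * E₂] hzE hz0 hzπ hE₂g hEπ₂ hE₂0 hgπ₂
    · have hd₁ : d₁ = 0 := (mul_eq_zero.1 h1).resolve_left hc₁
      have hd₂ : d₂ ≠ 0 := by
        intro hd₂; apply hw0; apply bc_inj; rw [hwπ, hd₁, hd₂, zero_smul, zero_smul, add_zero]
      have hc₂ : c₂ = 0 := (mul_eq_zero.1 h2).resolve_right hd₂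
      rw [hc₂, zero_smul, add_zero] at hzπ
      exact mkIdeal ![E₁, F₁, E₁ * F₁ - F₁ * E₁] hzE hz0 hzπ hE₁g hEπ₁ hE₁0 hgπ₁
  · -- no zero-divisors: `Zc` is a real quadratic field
    right
    push Not at hzd
    have hnzd : ∀ z ∈ Zc, ∀ w ∈ Zc, z * w = 0 → z = 0 ∨ w = 0 := by
      intro z hz w hw h
      by_contra hne
      push Not at hne
      exact hzd z hz w hw hne.1 hne.2 h
    -- a non-scalar `z₀ ∈ Zc`
    have h1ne : (1 : Module.End ℚ V) ≠ 0 := by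
      intro h
      apply hE₁0
      have h' : (1 : Module.End ℂ (ℂ ⊗[ℚ] V)) = 0 := by
        rw [← LinearMap.baseChange_one, h, LinearMap.baseChange_zero]
      rw [← mul_one E₁, h', mul_zero]
    have hlt : Submodule.span ℚ {(1 : Module.End ℚ V)} < Zc := by
      refine Submodule.lt_of_le_of_finrank_lt_finrank ((Submodule.span_singleton_le_iff_mem _ _).2 hZc1) ?_
      rw [hZ2, finrank_span_singleton h1ne]
      norm_num
    obtain ⟨z₀, hz₀, hz₀1⟩ := SetLike.exists_of_lt hlt
    -- `{1, z₀}` is a basis of `Zc`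
    have hind1 : LinearIndependent ℚ ![(1 : Module.End ℚ V), z₀] := by
      refine LinearIndependent.pair_iff.2 fun s t hst => ?_
      by_cases ht : t = 0
      · rw [ht, zero_smul, add_zero] at hst
        exact ⟨(smul_eq_zero.1 hst).resolve_right h1ne, ht⟩
      · exfalso; apply hz₀1
        rw [Submodule.mem_span_singleton]
        refine ⟨-(t⁻¹ * s), ?_⟩
        have h : t • z₀ = -(s • (1 : Module.End ℚ V)) := eq_neg_of_add_eq_zero_right hst
        calc -(t⁻¹ * s) • (1 : Module.End ℚ V) = t⁻¹ • (-(s • (1 : Module.End ℚ V))) := by module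
          _ = z₀ := by rw [← h, smul_smul, inv_mul_cancel₀ ht, one_smul]
    have hle : Submodule.span ℚ (Set.range ![(1 : Module.End ℚ V), z₀]) ≤ Zc := by
      rw [Submodule.span_le, Set.range_subset_iff]
      intro i; fin_cases i
      · exact hZc1
      · exact hz₀
    have heq : Submodule.span ℚ (Set.range ![(1 : Module.End ℚ V), z₀]) = Zc :=
      Submodule.eq_of_le_of_finrank_le hle (by rw [finrank_span_eq_card hind1, Fintype.card_fin, hZ2])
    have hbasis : ∀ z ∈ Zc, ∃ a b : ℚ, z = a • (1 : Module.End ℚ V) + b • z₀ := by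
      intro z hz
      rw [← heq, Matrix.range_cons, Matrix.range_cons, Matrix.range_empty, Set.union_empty, Set.singleton_union,
        Submodule.mem_span_pair] at hz
      obtain ⟨a, b, h⟩ := hz
      exact ⟨a, b, h.symm⟩
    -- `z₀² = a₀ z₀ + b₀`
    obtain ⟨b₀, a₀, hsq⟩ := hbasis _ (hZcmul z₀ hz₀ z₀ hz₀)
    set φ : Module.End ℚ V := (2 : ℚ) • z₀ - a₀ • (1 : Module.End ℚ V) with hφ
    have hφZ : φ ∈ Zc := Submodule.sub_mem _ (Submodule.smul_mem _ _ hz₀) (Submodule.smul_mem _ _ hZc1)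
    have hφφ : φ * φ = (a₀ ^ 2 + 4 * b₀) • (1 : Module.End ℚ V) := by
      have h : φ * φ = (4 : ℚ) • (z₀ * z₀) - (4 * a₀) • z₀ + (a₀ * a₀) • (1 : Module.End ℚ V) := by
        rw [hφ]
        simp only [sub_mul, mul_sub, smul_mul_assoc, mul_smul_comm, mul_one, one_mul]
        module
      rw [h, hsq]
      module
    have hφ1 : φ ∉ Submodule.span ℚ {(1 : Module.End ℚ V)} := by
      intro h
      apply hz₀1
      have hz₀φ : z₀ = (2 : ℚ)⁻¹ • (φ + a₀ • (1 : Module.End ℚ V)) := by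
        rw [hφ, sub_add_cancel, smul_smul, inv_mul_cancel₀ (two_ne_zero' ℚ), one_smul]
      rw [hz₀φ]
      exact Submodule.smul_mem _ _ (Submodule.add_mem _ h (Submodule.smul_mem _ _ (Submodule.mem_span_singleton_self _)))
    have hφ0 : φ ≠ 0 := fun h => hφ1 (by rw [h]; exact Submodule.zero_mem _)
    -- `q = a₀² + 4b₀` is positive and not a square
    set q : ℚ := a₀ ^ 2 + 4 * b₀ with hq
    have hq0 : q ≠ 0 := by
      intro h0
      rw [h0, zero_smul] at hφφ
      rcases hnzd φ hφZ φ hφZ hφφ with h | h <;> exact hφ0 h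
    -- reality: `φ_ℂ = c₁π₁ + c₂π₂` with `cᵢ` real, `c₁² = q`
    obtain ⟨c₁, c₂, hφπ, hc₁re, -⟩ := hdec φ hφZ
    -- base change of a rational multiple
    have bc_smul : ∀ (r : ℚ) (X : Module.End ℚ V), (r • X).baseChange ℂ = (r : ℂ) • X.baseChange ℂ := by
      intro r X
      refine LinearMap.ext fun v => ?_
      rw [LinearMap.smul_apply]
      induction v using TensorProduct.induction_on with
      | zero => rw [map_zero, map_zero, smul_zero]
      | tmul c w =>
        rw [LinearMap.baseChange_tmul, LinearMap.smul_apply, LinearMap.baseChange_tmul, TensorProduct.tmul_smul,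
          Rat.cast_smul_eq_qsmul]
      | add x y hx hy => rw [map_add, map_add, hx, hy, smul_add]
    have hqpos : 0 < q := by
      have hsqC := hmuldec hφπ hφπ
      rw [hφφ, bc_smul, LinearMap.baseChange_one, ← hsum1, smul_add] at hsqC
      -- `q • (π₁ + π₂) = c₁² • π₁ + c₂² • π₂`
      have h' : ((q : ℂ) - c₁ * c₁) • π₁ + ((q : ℂ) - c₂ * c₂) • π₂ = 0 := by
        calc ((q : ℂ) - c₁ * c₁) • π₁ + ((q : ℂ) - c₂ * c₂) • π₂
            = ((q : ℂ) • π₁ + (q : ℂ) • π₂) - ((c₁ * c₁) • π₁ + (c₂ * c₂) • π₂) := by module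
          _ = 0 := by rw [hsqC, sub_self]
      obtain ⟨h1, -⟩ := hπind _ _ h'
      have hq1 : (q : ℂ) = c₁ * c₁ := (sub_eq_zero.1 h1)
      -- `c₁` real
      have hc₁ : (c₁.re : ℂ) = c₁ := Complex.conj_eq_iff_re.1 hc₁re
      have hqR : (q : ℝ) = c₁.re * c₁.re := by
        have h : ((q : ℝ) : ℂ) = ((c₁.re * c₁.re : ℝ) : ℂ) := by
          rw [Complex.ofReal_mul, hc₁, ← hq1, Complex.ofReal_ratCast]
        exact_mod_cast h
      have hge : (0 : ℝ) ≤ q := by rw [hqR]; exact mul_self_nonneg _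
      have hge' : (0 : ℚ) ≤ q := by exact_mod_cast hge
      exact lt_of_le_of_ne hge' (Ne.symm hq0)
    have hnsq : ¬ IsSquare q := by
      rintro ⟨s, hs⟩
      -- `(φ - s)(φ + s) = φ² - s² = 0`
      have hprod : (φ - s • (1 : Module.End ℚ V)) * (φ + s • (1 : Module.End ℚ V)) = 0 := by
        have h : (φ - s • (1 : Module.End ℚ V)) * (φ + s • (1 : Module.End ℚ V)) =
            φ * φ - (s * s) • (1 : Module.End ℚ V) := by
          simp only [sub_mul, mul_add, smul_mul_assoc, mul_smul_comm, mul_one, one_mul]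
          module
        rw [h, hφφ, ← hs, sub_self]
      have hm : φ - s • (1 : Module.End ℚ V) ∈ Zc := Submodule.sub_mem _ hφZ (Submodule.smul_mem _ _ hZc1)
      have hp : φ + s • (1 : Module.End ℚ V) ∈ Zc := Submodule.add_mem _ hφZ (Submodule.smul_mem _ _ hZc1)
      rcases hnzd _ hm _ hp hprod with h | h
      · exact hφ1 (by rw [sub_eq_zero.1 h]; exact Submodule.smul_mem _ _ (Submodule.mem_span_singleton_self _))
      · have h' : φ = -(s • (1 : Module.End ℚ V)) := eq_neg_of_add_eq_zero_left h
        exact hφ1 (by rw [h', ← neg_smul]; exact Submodule.smul_mem _ _ (Submodule.mem_span_singleton_self _))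
    refine ⟨φ, q, hφZ, hqpos, hnsq, hφφ, fun z hz => ?_, hnzd⟩
    obtain ⟨a, b, h⟩ := hbasis z hz
    refine ⟨a + b * a₀ * (2 : ℚ)⁻¹, b * (2 : ℚ)⁻¹, ?_⟩
    rw [h, hφ]
    module

end HodgeStructure

end Literature.AlgebraicGeometry.Motives

end
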